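import Literature.Geometry.Kaehler.HolomorphicChainBlowUpChart
import Literature.Geometry.Kaehler.HolomorphicChainNormalChart
import Literature.Geometry.Kaehler.HolomorphicChainPlane
import Literature.Geometry.Kaehler.HolomorphicChainTangentCone
import Literature.Geometry.GeometricMeasureTheory.HomotopyRectifiable
import HarnessLib

/-!
# King's tangent-cone theorem at the regular points of a holomorphic chain

We prove the conclusion of `Literature.Geometry.Kaehler.King1971_tangentCone` ([Harvey1977,
Thm. 1.31]; Federer 4.3.18–4.3.19) at every point `b` of the CARRIER `reg |T|` of a holomorphic
`p`-chain `T` (`King1971_tangentCone_of_mem_carrier`): the blow-ups `D_r = (A_{b,r})_#[T] ⌞ B`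
converge in `𝓕^loc(B)` to the plane chain `C = k₀ • [T_b|T|]`, with the explicit flat
decomposition `D_r − [C] = ∂(k₀ • S_r)` on every `W ⊂⊂ B`, where `S_r` is the affine homotopy
current (`GraphHomotopy.lean`, `HomotopyRectifiable.lean`) between the tangent plane and the blown-up
sheet `g_r(k) = k + r⁻¹ v(r k)` (`HolomorphicChainNormalChart.lean`,
`HolomorphicChainBlowUpChart.lean`), whose mass is `O(sup ‖r⁻¹ v(r ·)‖) → 0` because `v(0) = 0`,
`Dv(0) = 0`.

## References

* R. Harvey, *Holomorphic chains and their boundaries*, PSPUM XXX.1 (1977), Thm. 1.31 [Harvey1977].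
* H. Federer, *Geometric Measure Theory*, Springer 1969, 4.3.16–4.3.19, 4.1.9 [Federer1969].
* J. King, *The currents defined by analytic varieties*, Acta Math. 127 (1971), 5.3.
-/

noncomputable section

open scoped Manifold Topology ENNReal NNReal InnerProductSpace Distributions ContDiff
open Set Filter MeasureTheory Metric Function Module TopologicalSpace InnerProductSpace

/-! ### Helpers on currents -/

namespace Literature.Geometry.GeometricMeasureTheory

-- Nested operator-norm instances on `Covector V m`, as in `Currents.lean`.
set_option maxSynthPendingDepth 2

section CurrentHelpers

variable {E : Type*} [NormedAddCommGroup E] [NormedSpace ℝ E] {F : Type*} [NormedAddCommGroup F]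
  [NormedSpace ℝ F]

/-- A smooth cutoff times a map smooth on an open set containing the cutoff's support is smooth
everywhere. [folklore] -/
theorem contDiff_smul_of_tsupport_subset {β : E → ℝ} (hβ : ContDiff ℝ ∞ β) {f : E → F} {U : Set E}
    (hU : IsOpen U) (hf : ContDiffOn ℝ ∞ f U) (hsupp : tsupport β ⊆ U) :
    ContDiff ℝ ∞ fun x => β x • f x := by
  rw [contDiff_iff_contDiffAt]
  intro x
  by_cases hx : x ∈ U
  · exact hβ.contDiffAt.smul (hf.contDiffAt (hU.mem_nhds hx))
  · have hx' : x ∉ tsupport β := fun h => hx (hsupp h)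
    have h0 : (fun y => β y • f y) =ᶠ[𝓝 x] fun _ => 0 := by
      filter_upwards [notMem_tsupport_iff_eventuallyEq.1 hx'] with y hy
      simp [hy]
    exact (contDiffAt_const (c := (0 : F))).congr_of_eventuallyEq h0

variable {Ω : Opens E} {m : ℕ}

/-- `|T(φ)| ≤ 𝐌(T)` for test forms of comass `≤ 1` (apply the defining bound to `φ` and `−φ`).
[cite: Federer1969, 4.1.7] -/
theorem Current.ofReal_abs_apply_le_mass (T : Current Ω m) {φ : TestForm Ω m}
    (hφ : ∀ x, ‖φ x‖ ≤ 1) : ENNReal.ofReal |T φ| ≤ T.mass := by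
  rcases le_or_gt 0 (T φ) with h | h
  · rw [abs_of_nonneg h]
    exact T.ofReal_apply_le_mass hφ
  · rw [abs_of_neg h, ← map_neg]
    exact T.ofReal_apply_le_mass fun x => by simpa using hφ x

/-- **`𝐌(c • T) ≤ |c| · 𝐌(T)`.** [cite: Federer1969, 4.1.7] -/
theorem Current.mass_smul_le (c : ℝ) (T : Current Ω m) :
    (c • T).mass ≤ ENNReal.ofReal |c| * T.mass := by
  refine iSup₂_le fun φ hφ => ?_
  calc ENNReal.ofReal ((c • T) φ) = ENNReal.ofReal (c * T φ) := rfl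
    _ ≤ ENNReal.ofReal (|c| * |T φ|) := ENNReal.ofReal_le_ofReal (by
        rw [← abs_mul]; exact le_abs_self _)
    _ = ENNReal.ofReal |c| * ENNReal.ofReal |T φ| := ENNReal.ofReal_mul (abs_nonneg _)
    _ ≤ ENNReal.ofReal |c| * T.mass := by gcongr; exact T.ofReal_abs_apply_le_mass hφ

/-- A current vanishing on the test forms supported in an open set `W` has no support in `W`.
[cite: Federer1969, 4.1.1] -/
theorem Current.support_inter_eq_empty_of_forall (T : Current Ω m) {W : Set E} (hW : IsOpen W)
    (h : ∀ φ : TestForm Ω m, tsupport ⇑φ ⊆ W → T φ = 0) : T.support ∩ W = ∅ := by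
  ext x
  simp only [mem_inter_iff, mem_empty_iff_false, iff_false, not_and]
  intro hx hxW
  obtain ⟨φ, hφ, hφT⟩ := hx.2 W (hW.mem_nhds hxW)
  exact hφT (h φ hφ)

end CurrentHelpers

end Literature.Geometry.GeometricMeasureTheory

namespace Literature.Geometry.Kaehler

open Literature.Geometry.GeometricMeasureTheory

-- Nested operator-norm instances on `Covector V m`, as in `Currents.lean`.
set_option maxSynthPendingDepth 2

universe u

/-! ### Helpers -/

section Helpers

/-- Complex-linear maps commute with `complexFrame`. [folklore] -/
theorem complexFrame_map {E F : Type*} [NormedAddCommGroup E] [InnerProductSpace ℂ E]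
    [NormedAddCommGroup F] [InnerProductSpace ℂ F] {p : ℕ} (f : E →ₗ[ℂ] F) (u : Fin p → E) :
    complexFrame (fun i => f (u i)) = fun j => f (complexFrame u j) := by
  funext j
  by_cases h : Even (j : ℕ)
  · simp [complexFrame, h]
  · simp [complexFrame, h]

end Helpers

/-! ### Smallness of the chart deviation `v = Ψ − b − ι` -/

section Deviation

variable {V : Type u} [NormedAddCommGroup V] [InnerProductSpace ℂ V] [FiniteDimensional ℂ V]
  {K : Submodule ℂ V} {ρ : ℝ} {Ψ : K → V} {b : V}

/-- **`v(k) = o(‖k‖)` and `Dv(k) = o(1)`** for `v = Ψ − b − ι` when `Ψ` is holomorphic near `0`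
with `Ψ 0 = b`, `DΨ(0) = ι`: for every `ε > 0` there is `η ∈ (0, ρ]` with `‖Ψ k − b − k‖ ≤ ε ‖k‖`
and `‖DΨ(k) − ι‖ ≤ ε` on `ball 0 η`. [folklore] -/
theorem exists_chart_deviation_le (hρ : 0 < ρ) (hΨ : DifferentiableOn ℂ Ψ (ball 0 ρ))
    (hΨ0 : Ψ 0 = b) (hDΨ0 : fderiv ℂ Ψ 0 = K.subtypeL) {ε : ℝ} (hε : 0 < ε) :
    ∃ η : ℝ, 0 < η ∧ η ≤ ρ ∧ ∀ k ∈ ball (0 : K) η,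
      ‖Ψ k - b - (k : V)‖ ≤ ε * ‖k‖ ∧ ‖fderiv ℂ Ψ k - K.subtypeL‖ ≤ ε := by
  have hC1 : ContDiffOn ℂ 1 Ψ (ball 0 ρ) :=
    Literature.Analysis.Complex.SCV.contDiffOn_nat hΨ isOpen_ball 1
  have hcont : ContinuousOn (fderiv ℂ Ψ) (ball 0 ρ) :=
    hC1.continuousOn_fderiv_of_isOpen isOpen_ball le_rfl
  have hcont0 : ContinuousAt (fderiv ℂ Ψ) 0 :=
    hcont.continuousAt (isOpen_ball.mem_nhds (mem_ball_self hρ))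
  obtain ⟨η₀, hη₀, hη₀ε⟩ := Metric.continuousAt_iff.1 hcont0 ε hε
  set η := min η₀ ρ with hη
  have hηpos : 0 < η := lt_min hη₀ hρ
  refine ⟨η, hηpos, min_le_right _ _, fun k hk => ?_⟩
  have hkρ : ball (0 : K) η ⊆ ball 0 ρ := ball_subset_ball (min_le_right _ _)
  have hderiv : ∀ k' ∈ ball (0 : K) η, ‖fderiv ℂ Ψ k' - K.subtypeL‖ ≤ ε := by
    intro k' hk'
    have h := hη₀ε (x := k') (by
      rw [dist_zero_right]; exact (mem_ball_zero_iff.1 hk').trans_le (min_le_left _ _))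
    rw [dist_eq_norm, hDΨ0] at h
    exact h.le
  refine ⟨?_, hderiv k hk⟩
  -- mean value inequality for `v = Ψ - b - ι` on the convex ball
  set v : K → V := fun k' => Ψ k' - b - (k' : V) with hv
  have hvd : ∀ k' ∈ ball (0 : K) η,
      HasFDerivWithinAt v (fderiv ℂ Ψ k' - K.subtypeL) (ball 0 η) k' := by
    intro k' hk'
    have h1 : HasFDerivAt Ψ (fderiv ℂ Ψ k') k' :=
      (hΨ.differentiableAt (isOpen_ball.mem_nhds (hkρ hk'))).hasFDerivAt
    exact ((h1.sub_const b).sub K.subtypeL.hasFDerivAt).hasFDerivWithinAt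
  have hmv := (convex_ball (0 : K) η).norm_image_sub_le_of_norm_hasFDerivWithin_le hvd hderiv
    (mem_ball_self hηpos) hk
  simpa [hv, hΨ0] using hmv

end Deviation

/-! ### King's theorem at the points of the carrier -/

section Main

open HolomorphicChain

set_option maxHeartbeats 6000000 in
/-- **King's tangent-cone theorem at a regular point** [Harvey1977, Thm. 1.31; Federer1969,
4.3.18]: at a point `b` of the carrier `reg |T|` of a holomorphic `p`-chain `T`, the blow-ups
`D_r` converge in `𝓕^loc(B(0,1))` to the plane chain `k₀ • [T_b|T|]` — with `R = 0` and `S` the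
affine homotopy current between the tangent plane and the blown-up sheet. [cite: Harvey1977, Thm. 1.31] -/
theorem King1971_tangentCone_of_mem_carrier (V : Type u) [NormedAddCommGroup V]
    [InnerProductSpace ℂ V] [FiniteDimensional ℂ V] [MeasurableSpace V] [BorelSpace V]
    (Ω : Opens V) (p : ℕ) (T : HolomorphicChain 𝓘(ℂ, V) Ω p) (b : V) (hb : b ∈ T.carrier) :
    letI : InnerProductSpace ℝ V := InnerProductSpace.complexToReal
    ∃ C : HolomorphicChain 𝓘(ℂ, V) (⊤ : Opens V) p,
      (∀ x ∈ C.support, ∀ c : ℂ, (⟨c • (x : V), trivial⟩ : (⊤ : Opens V)) ∈ C.support) ∧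
      ∀ (W : Set V), IsOpen W → IsCompact (closure W) → closure W ⊆ Metric.ball (0 : V) 1 →
        ∀ δ : ℝ≥0∞, 0 < δ → ∀ᶠ r in 𝓝[>] (0 : ℝ),
          ∃ (R : Current (unitBall V) (2 * p)) (S : Current (unitBall V) (2 * p + 1)),
            R.IsRectifiable ∧ S.IsRectifiable ∧
            (T.blowUp b r - C.toCurrentIn (unitBall V) - R - S.boundary).support ∩ W = ∅ ∧
            R.mass + S.mass < δ := by
  letI iV : InnerProductSpace ℝ V := InnerProductSpace.complexToReal
  haveI : ProperSpace V := FiniteDimensional.proper ℂ V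
  -- the normalised chart at `b`
  obtain ⟨K, π₁, ρ, Ψ, N, hKp, hπK, hρ, hNo, hbN, hNΩ, hΨ, hΨ0, hDΨ0, hleft, hcar, hcov, htan, k₀, hdens⟩ :=
    T.exists_normalChart hb
  letI iK : InnerProductSpace ℝ K := InnerProductSpace.complexToReal
  haveI : ProperSpace K := FiniteDimensional.proper ℂ K
  -- a unitary basis of `K`, its real frame, and the same vectors in `V`
  set bK : OrthonormalBasis (Fin p) ℂ K := (stdOrthonormalBasis ℂ K).reindex (finCongr hKp) with hbK
  obtain ⟨e, he⟩ := exists_orthonormalBasis_coe_eq_complexFrame bK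
  set uV : Fin p → V := fun i => (bK i : V) with huVdef
  have huV : Orthonormal ℂ uV := bK.orthonormal.comp_linearIsometry K.subtypeₗᵢ
  have hspanV : ((Submodule.span ℝ (Set.range (complexFrame uV)) : Submodule ℝ V) : Set V) =
      (K : Set V) := by
    rw [span_complexFrame_eq]
    have : Set.range uV = K.subtype '' Set.range ⇑bK := by
      ext v; simp [huVdef, Set.mem_range, Set.mem_image]
    rw [this, Submodule.span_image]
    have hspan : Submodule.span ℂ (Set.range ⇑bK) = ⊤ := bK.toBasis.span_eq ▸ by simp
    rw [hspan, Submodule.map_top, Submodule.range_subtype]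
  have hcfe : (fun j => ((e j : K) : V)) = complexFrame uV := by
    rw [he]
    exact (complexFrame_map K.subtype ⇑bK).symm
  -- the tangent cone `C = k₀ • [K]`
  refine ⟨k₀ • plane K hKp, fun x hx c => smul_mem_support_smul_plane K hKp k₀ hx c, ?_⟩
  intro W hWo hWc hW1 δ hδ
  obtain ⟨ρW, hρW1, hWρ⟩ := exists_lt_one_subset_ball_of_closure_subset hWc hW1
  -- radii `0 ≤ ρW' < ρ₂ < ρ₃ < 1`
  set ρW' : ℝ := max ρW 0 with hρW'
  have hρW'0 : 0 ≤ ρW' := le_max_right _ _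
  have hρW'1 : ρW' < 1 := max_lt hρW1 one_pos
  have hWρ' : W ⊆ ball (0 : V) ρW' := hWρ.trans (ball_subset_ball (le_max_left _ _))
  set ρ₂ : ℝ := (2 * ρW' + 1) / 3 with hρ₂
  set ρ₃ : ℝ := (ρW' + 2) / 3 with hρ₃
  have h₁₂ : ρW' < ρ₂ := by rw [hρ₂]; linarith
  have h₂₃ : ρ₂ < ρ₃ := by rw [hρ₂, hρ₃]; linarith
  have h₃₁ : ρ₃ < 1 := by rw [hρ₃]; linarith
  have hρ₂pos : 0 < ρ₂ := by rw [hρ₂]; linarith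
  -- the cutoff `β` on `K`: `= 1` near `closedBall 0 ρ₂`, supported in `ball 0 ρ₃`, `0 ≤ β ≤ 1`
  obtain ⟨β, Uβ, hUβo, hUβ, hβ1, hβ01⟩ := exists_testFunction_eq_one_nhds
    (Ω := (⟨ball (0 : K) ρ₃, isOpen_ball⟩ : Opens K)) (isCompact_closedBall (0 : K) ρ₂)
    (closedBall_subset_ball h₂₃)
  have hβsupp : tsupport (β : K → ℝ) ⊆ ball (0 : K) ρ₃ := β.tsupport_subset
  obtain ⟨Cβ, hCβ⟩ := (β.hasCompactSupport.fderiv (𝕜 := ℝ)).exists_bound_of_continuous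
    (β.contDiff.continuous_fderiv (by simp))
  have hCβ0 : 0 ≤ Cβ := (norm_nonneg _).trans (hCβ 0)
  -- the radius `R₀` of relevant parameters and the volume constant
  set R₀ : ℝ := max ‖π₁‖ 1 with hR₀
  have hR₀1 : 1 ≤ R₀ := le_max_right _ _
  have hR₀pos : 0 < R₀ := one_pos.trans_le hR₀1
  set Mvol : ℝ := ((volume : Measure K) (ball (0 : K) ρ₃)).toReal with hMvol
  have hMvol0 : 0 ≤ Mvol := ENNReal.toReal_nonneg
  -- the target `δr = (min δ 1).toReal > 0`
  set δ' : ℝ≥0∞ := min δ 1 with hδ'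
  have hδ'top : δ' ≠ ⊤ := ne_top_of_le_ne_top ENNReal.one_ne_top (min_le_right _ _)
  have hδ'pos : 0 < δ' := lt_min hδ one_pos
  set δr : ℝ := δ'.toReal with hδr
  have hδrpos : 0 < δr := ENNReal.toReal_pos hδ'pos.ne' hδ'top
  -- the smallness parameter `ε`
  set A₀ : ℝ := (|(k₀ : ℝ)| + 1) * 2 ^ (2 * p) * (Mvol + 1) with hA₀
  have hA₀pos : 0 < A₀ := by positivity
  set ε : ℝ := min (min (ρ₂ - ρW') ((1 - ρ₃) / 2)) (min (1 / (1 + Cβ)) (δr / (2 * A₀))) with hε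
  have hεpos : 0 < ε := by
    refine lt_min (lt_min (by linarith) (by linarith)) (lt_min (by positivity) (by positivity))
  have hε1 : ρW' + ε ≤ ρ₂ := by
    have : ε ≤ ρ₂ - ρW' := (min_le_left _ _).trans (min_le_left _ _); linarith
  have hε2 : ρ₃ + ε < 1 := by
    have : ε ≤ (1 - ρ₃) / 2 := (min_le_left _ _).trans (min_le_right _ _); linarith
  have hε2' : ρ₂ + ε < 1 := by linarith
  have hε3 : ε * (1 + Cβ) ≤ 1 := by
    have : ε ≤ 1 / (1 + Cβ) := (min_le_right _ _).trans (min_le_left _ _)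
    rwa [le_div_iff₀ (by positivity)] at this
  have hε4 : ε ≤ δr / (2 * A₀) := (min_le_right _ _).trans (min_le_right _ _)
  have hεle1 : ε ≤ 1 := by nlinarith
  -- the deviation estimate with `ε / R₀`
  obtain ⟨η, hη, hηρ, hdev⟩ := exists_chart_deviation_le hρ hΨ hΨ0 hDΨ0 (div_pos hεpos hR₀pos)
  -- the chart domain around `b`
  obtain ⟨rN, hrN, hrNN⟩ : ∃ rN > 0, closedBall b rN ⊆ N :=
    nhds_basis_closedBall.mem_iff.1 (hNo.mem_nhds hbN)
  -- the range of good radii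
  set r₀ : ℝ := min (η / (R₀ + 1)) rN with hr₀
  have hr₀pos : 0 < r₀ := lt_min (div_pos hη (by linarith)) hrN
  refine mem_of_superset (Ioo_mem_nhdsGT hr₀pos) fun r hr => ?_
  obtain ⟨hr, hrr₀⟩ := hr
  have hrη : r * R₀ < η := by
    have h1 : r < η / (R₀ + 1) := hrr₀.trans_le (min_le_left _ _)
    rw [lt_div_iff₀ (by linarith)] at h1
    nlinarith
  have hrN' : r < rN := hrr₀.trans_le (min_le_right _ _)
  have hΩr : closedBall b r ⊆ (Ω : Set V) := ((closedBall_subset_closedBall hrN'.le).trans hrNN).trans hNΩ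
  have hbr : ball b r ⊆ N := (ball_subset_closedBall.trans (closedBall_subset_closedBall hrN'.le)).trans hrNN
  -- parameters of norm `≤ R₀` are mapped into `ball 0 η ⊆ ball 0 ρ` by `k ↦ r • k`
  have hrk : ∀ k : K, ‖k‖ ≤ R₀ → (r : ℝ) • k ∈ ball (0 : K) η := by
    intro k hk
    rw [mem_ball_zero_iff, norm_smul, Real.norm_of_nonneg hr.le]
    nlinarith
  have hηρ' : ball (0 : K) η ⊆ ball 0 ρ := ball_subset_ball hηρ
  -- the blown-up sheet `g = g_r` and its deviation `w = g − ι`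
  set g : K → V := blowUpChart Ψ b r with hg
  set w : K → V := fun k => g k - (k : V) with hw
  set Dw : K → K →L[ℝ] V := fun k =>
    (fderiv ℂ Ψ ((r : ℝ) • k)).restrictScalars ℝ - (K.subtypeL : K →L[ℂ] V).restrictScalars ℝ
    with hDw
  have hw_eq : ∀ k : K, w k = r⁻¹ • (Ψ ((r : ℝ) • k) - b - (((r : ℝ) • k : K) : V)) := by
    intro k
    rw [Submodule.coe_smul_of_tower, smul_sub r⁻¹ (Ψ ((r : ℝ) • k) - b), inv_smul_smul₀ hr.ne']
    rfl
  have hw_norm : ∀ k : K, ‖k‖ ≤ R₀ → ‖w k‖ ≤ ε := by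
    intro k hk
    have h := (hdev _ (hrk k hk)).1
    rw [hw_eq, norm_smul, norm_inv, Real.norm_of_nonneg hr.le]
    rw [norm_smul, Real.norm_of_nonneg hr.le] at h
    calc r⁻¹ * ‖Ψ ((r : ℝ) • k) - b - (((r : ℝ) • k : K) : V)‖ ≤ r⁻¹ * (ε / R₀ * (r * ‖k‖)) :=
          mul_le_mul_of_nonneg_left h (inv_nonneg.2 hr.le)
      _ = ε / R₀ * ‖k‖ := by field_simp
      _ ≤ ε / R₀ * R₀ := mul_le_mul_of_nonneg_left hk (div_nonneg hεpos.le hR₀pos.le)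
      _ = ε := div_mul_cancel₀ ε hR₀pos.ne'
  have hw_deriv : ∀ k : K, ‖k‖ ≤ R₀ → HasFDerivAt w (Dw k) k := by
    intro k hk
    have h1 := hasFDerivAt_blowUpChart hΨ b hr (hηρ' (hrk k hk))
    exact h1.sub ((K.subtypeL : K →L[ℂ] V).restrictScalars ℝ).hasFDerivAt
  have hDw_norm : ∀ k : K, ‖k‖ ≤ R₀ → ‖Dw k‖ ≤ ε := by
    intro k hk
    have h := (hdev _ (hrk k hk)).2
    rw [hDw]
    simp only
    rw [← ContinuousLinearMap.restrictScalars_sub, ContinuousLinearMap.norm_restrictScalars]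
    exact h.trans (div_le_self hεpos.le hR₀1)
  -- the compactly supported perturbation `u = β • w`
  set u : K → V := fun k => β k • w k with hu
  have hρ₃R₀ : ρ₃ ≤ R₀ := h₃₁.le.trans hR₀1
  have hβR₀ : ∀ k : K, k ∈ tsupport (β : K → ℝ) → ‖k‖ ≤ R₀ := fun k hk =>
    ((mem_ball_zero_iff.1 (hβsupp hk)).le).trans hρ₃R₀
  have hu_zero : ∀ k : K, k ∉ tsupport (β : K → ℝ) → u k = 0 := fun k hk => by
    simp only [hu, image_eq_zero_of_notMem_tsupport hk, zero_smul]
  have hu_norm : ∀ k : K, ‖u k‖ ≤ ε := by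
    intro k
    by_cases hk : k ∈ tsupport (β : K → ℝ)
    · rw [hu]
      simp only [norm_smul, Real.norm_eq_abs]
      have hb1 : |β k| ≤ 1 := abs_le.2 ⟨by linarith [(hβ01 k).1], (hβ01 k).2⟩
      calc |β k| * ‖w k‖ ≤ 1 * ε :=
            mul_le_mul hb1 (hw_norm k (hβR₀ k hk)) (norm_nonneg _) zero_le_one
        _ = ε := one_mul ε
    · rw [hu_zero k hk, norm_zero]
      exact hεpos.le
  have hηr : ball (0 : K) ρ₃ ⊆ ball 0 (η / r) := by
    refine ball_subset_ball ?_
    rw [le_div_iff₀ hr]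
    nlinarith
  have hwC : ContDiffOn ℝ ∞ w (ball (0 : K) (η / r)) := by
    have hmaps : MapsTo (fun k : K => (r : ℝ) • k) (ball (0 : K) (η / r)) (ball 0 ρ) := by
      intro k hk
      exact hηρ' ((smul_mem_ball_zero_iff hr k).2 hk)
    have hsm : DifferentiableOn ℂ (fun k : K => (r : ℝ) • k) (ball (0 : K) (η / r)) :=
      (differentiable_id.const_smul (r : ℝ)).differentiableOn
    have hΨc : DifferentiableOn ℂ (fun k : K => Ψ ((r : ℝ) • k)) (ball (0 : K) (η / r)) :=
      hΨ.comp hsm hmaps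
    have hC : ContDiffOn ℂ ∞ (fun k : K => Ψ ((r : ℝ) • k)) (ball (0 : K) (η / r)) :=
      contDiffOn_infty.2 fun n => Literature.Analysis.Complex.SCV.contDiffOn_nat hΨc isOpen_ball n
    have hC' : ContDiffOn ℝ ∞ (fun k : K => Ψ ((r : ℝ) • k)) (ball (0 : K) (η / r)) :=
      hC.restrict_scalars ℝ
    have h2 : ContDiffOn ℝ ∞ (fun k : K => r⁻¹ • (Ψ ((r : ℝ) • k) - b) - (k : V))
        (ball (0 : K) (η / r)) :=
      ((hC'.sub contDiffOn_const).const_smul r⁻¹).sub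
        ((K.subtypeL : K →L[ℂ] V).restrictScalars ℝ).contDiff.contDiffOn
    exact h2
  have hu_smooth : ContDiff ℝ ∞ u :=
    contDiff_smul_of_tsupport_subset β.contDiff isOpen_ball hwC (hβsupp.trans hηr)
  have hu_supp : HasCompactSupport u := β.hasCompactSupport.smul_right
  have hu_tsupp : tsupport u ⊆ ball (0 : K) ρ₃ := (tsupport_smul_subset_left _ _).trans hβsupp
  set ι : K →L[ℝ] V := (K.subtypeL : K →L[ℂ] V).restrictScalars ℝ with hι
  set π₁' : V →L[ℝ] K := π₁.restrictScalars ℝ with hπ₁'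
  have hιapply : ∀ k : K, ι k = (k : V) := fun k => rfl
  have hπι : ∀ k : K, π₁' (ι k) = k := fun k => hπK k
  have hπw : ∀ k : K, ‖k‖ ≤ R₀ → π₁ (w k) = 0 := by
    intro k hk
    rw [hw]
    simp only [map_sub, hg, apply_blowUpChart_eq Ψ b π₁ hleft hr (hηρ' (hrk k hk)), hπK k, sub_self]
  have hπu : ∀ k : K, π₁' (u k) = 0 := by
    intro k
    by_cases hk : k ∈ tsupport (β : K → ℝ)
    · rw [hπ₁', ContinuousLinearMap.coe_restrictScalars', hu]
      simp only [ContinuousLinearMap.map_smul_of_tower, hπw k (hβR₀ k hk), smul_zero]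
    · rw [hu_zero k hk, map_zero]
  -- the swept surface stays inside the unit ball
  have hΩ' : graphHomotopy ι u '' (Icc (0 : ℝ) 1 ×ˢ tsupport u) ⊆ (unitBall V : Set V) := by
    rintro _ ⟨⟨t, k⟩, ⟨ht, hk⟩, rfl⟩
    show ι k + t • u k ∈ ball (0 : V) 1
    rw [mem_ball_zero_iff]
    have hk3 : ‖k‖ < ρ₃ := mem_ball_zero_iff.1 (hu_tsupp hk)
    calc ‖ι k + t • u k‖ ≤ ‖ι k‖ + ‖t • u k‖ := norm_add_le _ _
      _ = ‖k‖ + |t| * ‖u k‖ := by rw [hιapply, Submodule.norm_coe, norm_smul, Real.norm_eq_abs]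
      _ ≤ ‖k‖ + 1 * ε := by
          gcongr
          · exact abs_le.2 ⟨by linarith [ht.1], ht.2⟩
          · exact hu_norm k
      _ < ρ₃ + ε := by linarith
      _ < 1 := hε2
  -- the affine homotopy current
  obtain ⟨S, hS, hSb, hSm, hSs, hSrect⟩ := exists_graphHomotopyCurrent_isRectifiable ι π₁' e
    hu_smooth hu_supp hπι hπu (isCompact_closedBall (0 : K) 1) hΩ'
  refine ⟨0, (k₀ : ℝ) • S, Current.isRectifiable_zero, hSrect k₀, ?_, ?_⟩
  · ------------------------------------------------------------------ support
    refine Current.support_inter_eq_empty_of_forall _ hWo fun φ hφ => ?_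
    -- test forms supported in `W ⊆ ball 0 ρW'`
    have hφ0 : ∀ y : V, ρW' ≤ ‖y‖ → (φ : V → Covector V (2 * p)) y = 0 := fun y hy =>
      image_eq_zero_of_notMem_tsupport fun h => by
        have := mem_ball_zero_iff.1 (hWρ' (hφ h)); linarith
    have hφKc : ∀ x : K, x ∉ closedBall (0 : K) 1 → (φ : V → Covector V (2 * p)) (ι x) = 0 := by
      intro x hx
      refine hφ0 _ ?_
      rw [hιapply, Submodule.norm_coe]
      rw [mem_closedBall_zero_iff, not_le] at hx
      linarith
    -- the three currents on `φ`
    set Q : Set K := {k | k ∈ ball (0 : K) (ρ / r) ∧ blowUpChart Ψ b r k ∈ ball (0 : V) 1} with hQ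
    set F : K → ℝ := fun k => φ (g k) fun j => (fderiv ℂ Ψ ((r : ℝ) • k)) (e j) with hF
    set G : K → ℝ := fun x => φ (ι x + u x) fun j => ι (e j) + fderiv ℝ u x (e j) with hG
    have hD : T.blowUp b r φ = (k₀ : ℝ) * ∫ k in Q, F k :=
      T.blowUp_apply_eq_chart_integral hKp hΨ hleft hcar hcov htan hdens bK hr hΩr hbr φ e he
    have hC : (k₀ • plane K hKp).toCurrentIn (unitBall V) φ =
        (k₀ : ℝ) * ∫ x : K, φ x (complexFrame uV) :=
      toCurrentIn_smul_plane_apply_volume K hKp huV hspanV k₀ _ φ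
    have hB : S.boundary φ = (∫ x, G x) - ∫ x : K, φ (ι x) fun j => ι (e j) := hSb φ hφKc
    have hbottom : (∫ x : K, φ (ι x) fun j => ι (e j)) = ∫ x : K, φ x (complexFrame uV) := by
      congr 1
      funext x
      rw [hιapply, ← hcfe]
      rfl
    -- Claim A: on `closedBall 0 ρ₂` the two integrands agree and the points lie in `Q`
    have hA : ∀ k : K, ‖k‖ ≤ ρ₂ → k ∈ Q ∧ G k = F k := by
      intro k hk
      have hkR : ‖k‖ ≤ R₀ := hk.trans (h₂₃.le.trans hρ₃R₀)
      have hkU : k ∈ Uβ := hUβ (mem_closedBall_zero_iff.2 hk)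
      have hloc : u =ᶠ[𝓝 k] w := by
        filter_upwards [hUβo.mem_nhds hkU] with k' hk'
        simp only [hu, hβ1 k' hk', one_smul]
      have huk : u k = w k := hloc.self_of_nhds
      have hDu : fderiv ℝ u k = Dw k := by rw [hloc.fderiv_eq, (hw_deriv k hkR).fderiv]
      have hgk : ι k + u k = g k := by rw [huk, hιapply]; exact add_sub_cancel _ _
      refine ⟨⟨(smul_mem_ball_zero_iff hr k).1 (hηρ' (hrk k hkR)), ?_⟩, ?_⟩
      · show g k ∈ ball (0 : V) 1
        rw [mem_ball_zero_iff, ← hgk, hιapply, huk]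
        calc ‖(k : V) + w k‖ ≤ ‖(k : V)‖ + ‖w k‖ := norm_add_le _ _
          _ ≤ ρ₂ + ε := by rw [Submodule.norm_coe]; exact add_le_add hk (hw_norm k hkR)
          _ < 1 := hε2'
      · simp only [hG, hF, hgk, hDu, hDw]
        congr 1
        funext j
        simp [hιapply]
    -- Claim B: `G` is supported in `closedBall 0 ρ₂`
    have hBsupp : ∀ k : K, G k ≠ 0 → ‖k‖ ≤ ρ₂ := by
      intro k hk
      have hne : (φ : V → Covector V (2 * p)) (ι k + u k) ≠ 0 := fun h => hk (by simp [hG, h])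
      have hlt : ‖ι k + u k‖ < ρW' := lt_of_not_ge fun h => hne (hφ0 _ h)
      have h1 : ‖k‖ ≤ ‖ι k + u k‖ + ‖u k‖ := by
        calc ‖k‖ = ‖ι k‖ := by rw [hιapply, Submodule.norm_coe]
          _ = ‖(ι k + u k) - u k‖ := by rw [add_sub_cancel_right]
          _ ≤ ‖ι k + u k‖ + ‖u k‖ := norm_sub_le _ _
      linarith [hu_norm k]
    -- Claim C: `F` is supported in `closedBall 0 ρ₂` on `Q`
    have hCsupp : ∀ k ∈ Q, F k ≠ 0 → ‖k‖ ≤ ρ₂ := by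
      intro k hkQ hk
      have hne : (φ : V → Covector V (2 * p)) (g k) ≠ 0 := fun h => hk (by simp [hF, h])
      have hlt : ‖g k‖ < ρW' := lt_of_not_ge fun h => hne (hφ0 _ h)
      have hg1 : ‖g k‖ < 1 := mem_ball_zero_iff.1 hkQ.2
      have hrk' : (r : ℝ) • k ∈ ball (0 : K) ρ := (smul_mem_ball_zero_iff hr k).2 hkQ.1
      have hkπ : ‖k‖ ≤ R₀ := by
        have h1 : k = π₁ (g k) := (apply_blowUpChart_eq Ψ b π₁ hleft hr hrk').symm
        calc ‖k‖ = ‖π₁ (g k)‖ := by rw [← h1]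
          _ ≤ ‖π₁‖ * ‖g k‖ := π₁.le_opNorm _
          _ ≤ ‖π₁‖ * 1 := mul_le_mul_of_nonneg_left hg1.le (norm_nonneg _)
          _ ≤ R₀ := by rw [mul_one]; exact le_max_left _ _
      have h1 : ‖k‖ ≤ ‖g k‖ + ‖w k‖ := by
        calc ‖k‖ = ‖(k : V)‖ := (Submodule.norm_coe k).symm
          _ = ‖g k - w k‖ := by rw [show w k = g k - (k : V) from rfl, sub_sub_cancel]
          _ ≤ ‖g k‖ + ‖w k‖ := norm_sub_le _ _
      linarith [hw_norm k hkπ]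
    -- `Q` is open
    have hgc : ContinuousOn g (ball (0 : K) (ρ / r)) := fun k hk =>
      (hasFDerivAt_blowUpChart hΨ b hr ((smul_mem_ball_zero_iff hr k).2 hk)).continuousAt
        |>.continuousWithinAt
    have hQo : IsOpen Q :=
      hgc.isOpen_inter_preimage (t := ball (0 : V) 1) isOpen_ball isOpen_ball
    -- the integral identity `∫_Q F = ∫ G`
    have htop : (∫ k in Q, F k) = ∫ x, G x := by
      have h1 : (∫ k in Q, F k) = ∫ k in closedBall (0 : K) ρ₂, F k := by
        refine setIntegral_eq_of_subset_of_forall_sdiff_eq_zero hQo.measurableSet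
          (fun k hk => (hA k (mem_closedBall_zero_iff.1 hk)).1) fun k hk => ?_
        by_contra hne
        exact hk.2 (mem_closedBall_zero_iff.2 (hCsupp k hk.1 hne))
      have h2 : (∫ k in closedBall (0 : K) ρ₂, F k) = ∫ k in closedBall (0 : K) ρ₂, G k :=
        setIntegral_congr_fun measurableSet_closedBall fun k hk =>
          ((hA k (mem_closedBall_zero_iff.1 hk)).2).symm
      have h3 : (∫ k in closedBall (0 : K) ρ₂, G k) = ∫ x, G x :=
        setIntegral_eq_integral_of_forall_compl_eq_zero fun k hk => by
          by_contra hne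
          exact hk (mem_closedBall_zero_iff.2 (hBsupp k hne))
      rw [h1, h2, h3]
    -- assembly
    show (T.blowUp b r - (k₀ • plane K hKp).toCurrentIn (unitBall V) - 0 -
      ((k₀ : ℝ) • S).boundary) φ = 0
    rw [Current.boundary_smul, sub_zero, _root_.sub_apply, _root_.sub_apply,
      _root_.smul_apply, smul_eq_mul, hD, hC, hB, hbottom, htop]
    ring
  · ------------------------------------------------------------------ mass
    rw [Current.mass_zero, zero_add]
    refine lt_of_le_of_lt ((Current.mass_smul_le (k₀ : ℝ) S).trans
      (mul_le_mul_right hSm _)) ?_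
    -- bound the mass integral by `ε 2^{2p} Mvol`
    set ν : Measure (ℝ × K) := ((volume : Measure ℝ).restrict (Icc 0 1)).prod (volume : Measure K)
      with hν
    have hfd_u : ∀ k : K, ‖k‖ ≤ R₀ → ‖fderiv ℝ u k‖ ≤ 1 := by
      intro k hk
      have hβd : DifferentiableAt ℝ (β : K → ℝ) k := (β.contDiff.differentiable (by simp)).differentiableAt
      have hwd : DifferentiableAt ℝ w k := (hw_deriv k hk).differentiableAt
      rw [show u = fun y => β y • w y from rfl, fderiv_fun_smul hβd hwd, (hw_deriv k hk).fderiv]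
      have hb1 : |β k| ≤ 1 := abs_le.2 ⟨by linarith [(hβ01 k).1], (hβ01 k).2⟩
      calc ‖β k • Dw k + (fderiv ℝ (β : K → ℝ) k).smulRight (w k)‖
          ≤ ‖β k • Dw k‖ + ‖(fderiv ℝ (β : K → ℝ) k).smulRight (w k)‖ := norm_add_le _ _
        _ = |β k| * ‖Dw k‖ + ‖fderiv ℝ (β : K → ℝ) k‖ * ‖w k‖ := by
            rw [norm_smul, Real.norm_eq_abs, ContinuousLinearMap.norm_smulRight_apply]
        _ ≤ 1 * ε + Cβ * ε := by
            gcongr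
            · exact hDw_norm k hk
            · exact hCβ k
            · exact hw_norm k hk
        _ = ε * (1 + Cβ) := by ring
        _ ≤ 1 := hε3
    have hptw : ∀ z : ℝ × K, z.1 ∈ Icc (0 : ℝ) 1 →
        ‖u z.2‖ * ∏ j, ‖ι (e j) + z.1 • fderiv ℝ u z.2 (e j)‖ ≤
          (tsupport (β : K → ℝ)).indicator (fun _ => ε * 2 ^ (2 * p)) z.2 := by
      intro z hz
      by_cases hk : z.2 ∈ tsupport (β : K → ℝ)
      · rw [indicator_of_mem hk]
        have hkR := hβR₀ _ hk
        have hfac : ∀ j, ‖ι (e j) + z.1 • fderiv ℝ u z.2 (e j)‖ ≤ 2 := by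
          intro j
          have hej : ‖ι (e j)‖ = 1 := by rw [hιapply, Submodule.norm_coe, e.orthonormal.1 j]
          calc ‖ι (e j) + z.1 • fderiv ℝ u z.2 (e j)‖
              ≤ ‖ι (e j)‖ + ‖z.1 • fderiv ℝ u z.2 (e j)‖ := norm_add_le _ _
            _ ≤ 1 + 1 * (1 * 1) := by
                rw [hej, norm_smul, Real.norm_eq_abs]
                gcongr
                · exact abs_le.2 ⟨by linarith [hz.1], hz.2⟩
                · calc ‖fderiv ℝ u z.2 (e j)‖ ≤ ‖fderiv ℝ u z.2‖ * ‖e j‖ :=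
                        (fderiv ℝ u z.2).le_opNorm _
                    _ ≤ 1 * 1 := by
                        gcongr
                        · exact hfd_u _ hkR
                        · exact (e.orthonormal.1 j).le
            _ = 2 := by norm_num
        calc ‖u z.2‖ * ∏ j, ‖ι (e j) + z.1 • fderiv ℝ u z.2 (e j)‖
            ≤ ε * ∏ _j : Fin (2 * p), (2 : ℝ) :=
              mul_le_mul (hu_norm _) (Finset.prod_le_prod (fun j _ => norm_nonneg _) fun j _ => hfac j)
                (Finset.prod_nonneg fun j _ => norm_nonneg _) hεpos.le
          _ = ε * 2 ^ (2 * p) := by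
              rw [Finset.prod_const, Finset.card_univ, Fintype.card_fin]
      · rw [indicator_of_notMem hk, hu_zero _ hk, norm_zero, zero_mul]
    have hβm : MeasurableSet (tsupport (β : K → ℝ)) := (isClosed_tsupport _).measurableSet
    have hβfin : (volume : Measure K) (tsupport (β : K → ℝ)) ≤ (volume : Measure K) (ball 0 ρ₃) :=
      measure_mono hβsupp
    have hballfin : (volume : Measure K) (ball (0 : K) ρ₃) ≠ ⊤ := measure_ball_lt_top.ne
    have hdom : Integrable (fun z : ℝ × K =>
        (tsupport (β : K → ℝ)).indicator (fun _ => ε * 2 ^ (2 * p)) z.2) ν := by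
      have : (fun z : ℝ × K => (tsupport (β : K → ℝ)).indicator (fun _ => ε * 2 ^ (2 * p)) z.2) =
          (univ ×ˢ tsupport (β : K → ℝ)).indicator fun _ => ε * 2 ^ (2 * p) := by
        funext z
        by_cases hk : z.2 ∈ tsupport (β : K → ℝ)
        · rw [indicator_of_mem hk, indicator_of_mem (show z ∈ univ ×ˢ _ from ⟨mem_univ _, hk⟩)]
        · rw [indicator_of_notMem hk, indicator_of_notMem (fun h => hk h.2)]
      rw [this]
      refine (integrable_indicator_iff (MeasurableSet.univ.prod hβm)).2 (integrableOn_const ?_)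
      rw [hν, Measure.prod_prod]
      exact ENNReal.mul_ne_top (by simp [Real.volume_Icc]) (ne_top_of_le_ne_top hballfin hβfin)
    have hae : ∀ᵐ z ∂ν, z.1 ∈ Icc (0 : ℝ) 1 :=
      (Measure.quasiMeasurePreserving_fst (μ := (volume : Measure ℝ).restrict (Icc 0 1))
        (ν := (volume : Measure K))).ae (ae_restrict_mem measurableSet_Icc)
    have hI : (∫ z, ‖u z.2‖ * ∏ j, ‖ι (e j) + z.1 • fderiv ℝ u z.2 (e j)‖ ∂ν) ≤
        ε * 2 ^ (2 * p) * Mvol := by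
      calc (∫ z, ‖u z.2‖ * ∏ j, ‖ι (e j) + z.1 • fderiv ℝ u z.2 (e j)‖ ∂ν)
          ≤ ∫ z, (tsupport (β : K → ℝ)).indicator (fun _ => ε * 2 ^ (2 * p)) z.2 ∂ν := by
            refine integral_mono_of_nonneg (Eventually.of_forall fun z => ?_) hdom ?_
            · exact mul_nonneg (norm_nonneg _) (Finset.prod_nonneg fun j _ => norm_nonneg _)
            · filter_upwards [hae] with z hz
              exact hptw z hz
        _ = ε * 2 ^ (2 * p) * ((volume : Measure K) (tsupport (β : K → ℝ))).toReal := by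
            have : (fun z : ℝ × K => (tsupport (β : K → ℝ)).indicator (fun _ => ε * 2 ^ (2 * p)) z.2) =
                (univ ×ˢ tsupport (β : K → ℝ)).indicator fun _ => ε * 2 ^ (2 * p) := by
              funext z
              by_cases hk : z.2 ∈ tsupport (β : K → ℝ)
              · rw [indicator_of_mem hk, indicator_of_mem (show z ∈ univ ×ˢ _ from ⟨mem_univ _, hk⟩)]
              · rw [indicator_of_notMem hk, indicator_of_notMem (fun h => hk h.2)]
            rw [this, integral_indicator (MeasurableSet.univ.prod hβm), setIntegral_const,
              smul_eq_mul, mul_comm]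
            congr 1
            rw [Measure.real, hν, Measure.prod_prod, Measure.restrict_apply_univ, Real.volume_Icc, sub_zero,
              ENNReal.ofReal_one, one_mul]
        _ ≤ ε * 2 ^ (2 * p) * Mvol := by
            gcongr
            rw [hMvol]
            exact ENNReal.toReal_mono hballfin hβfin
    have hI0 : 0 ≤ ∫ z, ‖u z.2‖ * ∏ j, ‖ι (e j) + z.1 • fderiv ℝ u z.2 (e j)‖ ∂ν :=
      integral_nonneg fun z => mul_nonneg (norm_nonneg _) (Finset.prod_nonneg fun j _ => norm_nonneg _)
    calc ENNReal.ofReal |(k₀ : ℝ)| *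
          ENNReal.ofReal (∫ z, ‖u z.2‖ * ∏ j, ‖ι (e j) + z.1 • fderiv ℝ u z.2 (e j)‖ ∂ν)
        ≤ ENNReal.ofReal |(k₀ : ℝ)| * ENNReal.ofReal (ε * 2 ^ (2 * p) * Mvol) := by
          gcongr
      _ = ENNReal.ofReal (|(k₀ : ℝ)| * (ε * 2 ^ (2 * p) * Mvol)) :=
          (ENNReal.ofReal_mul (abs_nonneg _)).symm
      _ < δ' := by
          rw [ENNReal.ofReal_lt_iff_lt_toReal (by positivity) hδ'top]
          have hk : |(k₀ : ℝ)| ≤ |(k₀ : ℝ)| + 1 := by linarith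
          have hM : Mvol ≤ Mvol + 1 := by linarith
          have h1 : |(k₀ : ℝ)| * (ε * 2 ^ (2 * p) * Mvol) ≤ A₀ * ε := by
            calc |(k₀ : ℝ)| * (ε * 2 ^ (2 * p) * Mvol)
                ≤ (|(k₀ : ℝ)| + 1) * (ε * 2 ^ (2 * p) * (Mvol + 1)) := by gcongr
              _ = A₀ * ε := by rw [hA₀]; ring
          have h2 : ε * (2 * A₀) ≤ δr := (le_div_iff₀ (by positivity)).1 hε4
          show |(k₀ : ℝ)| * (ε * 2 ^ (2 * p) * Mvol) < δr
          nlinarith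
      _ ≤ δ := min_le_left _ _

/-- **King's tangent-cone theorem off the singular locus**: the conclusion of
`King1971_tangentCone` at every `b ∈ Ω` outside `|T| ∖ reg|T|` (points of the carrier:
`King1971_tangentCone_of_mem_carrier`; points off `|T|`: `King1971_tangentCone_of_notMem_support`,
cone `0`). [cite: Harvey1977, Thm. 1.31] -/
theorem King1971_tangentCone_of_notMem_singular (V : Type u) [NormedAddCommGroup V]
    [InnerProductSpace ℂ V] [FiniteDimensional ℂ V] [MeasurableSpace V] [BorelSpace V]
    (Ω : Opens V) (p : ℕ) (T : HolomorphicChain 𝓘(ℂ, V) Ω p) (b : V) (hb : b ∈ Ω)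
    (hns : b ∉ ((((↑) : Ω → V) '' T.support : Set V) \ T.carrier)) :
    letI : InnerProductSpace ℝ V := InnerProductSpace.complexToReal
    ∃ C : HolomorphicChain 𝓘(ℂ, V) (⊤ : Opens V) p,
      (∀ x ∈ C.support, ∀ c : ℂ, (⟨c • (x : V), trivial⟩ : (⊤ : Opens V)) ∈ C.support) ∧
      ∀ (W : Set V), IsOpen W → IsCompact (closure W) → closure W ⊆ Metric.ball (0 : V) 1 →
        ∀ δ : ℝ≥0∞, 0 < δ → ∀ᶠ r in 𝓝[>] (0 : ℝ),
          ∃ (R : Current (unitBall V) (2 * p)) (S : Current (unitBall V) (2 * p + 1)),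
            R.IsRectifiable ∧ S.IsRectifiable ∧
            (T.blowUp b r - C.toCurrentIn (unitBall V) - R - S.boundary).support ∩ W = ∅ ∧
            R.mass + S.mass < δ := by
  by_cases hc : b ∈ T.carrier
  · exact King1971_tangentCone_of_mem_carrier V Ω p T b hc
  · exact King1971_tangentCone_of_notMem_support V Ω p T b hb fun h => hns ⟨h, hc⟩

end Main

end Literature.Geometry.Kaehler
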